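import Literature.Barriers.CriticalPhenomena.PositionSpaceRGNonGibbsianTorusPeierls
import Literature.Probability.LatticeModels.IsingConsistency
import Literature.Probability.LatticeModels.IsingBoundaryMonotonicity
import HarnessLib

/-!
# From the torus to the box: transport of finite-volume Gibbs expectations along the projection,
# and the DLR–FKG comparison of the `+`-exterior box with the pinned torus

Support file for the Theorem 4.3 line of the barrier
`Literature/Barriers/CriticalPhenomena/PositionSpaceRGNonGibbsian.lean` (van Enter–Fernández–Sokal
1993, Theorem 4.3: the `+` phase of the internal spins with alternating frozen image spins, `b ≥ 3`,
here via reflection positivity on a torus instead of the source's Pirogov–Sinai route, §4.3.2).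
The chessboard estimate lives on the torus `(ℤ/Nbℤ)^d`; the plus-phase bound `VEFS1993_plusPhase` is
about the box `Λ_{R'}` of `ℤ^d` with alternating image spins inside and `+` spins outside. This file
provides the bridge:

* `isingExpect_fixed_transport` (**transport of Gibbs expectations along a local isomorphism of
  graphs**): for a map `φ : V → V'` injective on `Λ ∪ ∂Λ` which carries the edges at `Λ` bijectively
  onto the edges at `φ(Λ)`, `⟨f ∘ φ^*⟩^{ξ}_{φ(Λ)} = ⟨f⟩^{ξ ∘ φ}_{Λ}` for `Λ`-local `f`
  (finite Boltzmann sums re-indexed; Friedli–Velenik §3.1).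
* `isingExpect_mul_tExpect_le` (**DLR–FKG comparison**, Friedli–Velenik Lemma 6.7 / Exercise 3.11
  (spatial Markov property) with Lemma 3.23 / Exercise 3.13 (monotonicity in the boundary
  condition)): let `Λ^int` be the internal sites of `Λ_{R'} = box d (bR')`, `η_p` the boundary
  condition `signedCoreAnnulusBC d b p R' R' 1 1` of `VEFS1993_plusPhase` (image spins of `Λ_{R'}`
  frozen to `p·ω'_alt`, everything else `+`), and embed `Λ_{R'}` in the torus `(ℤ/Nbℤ)^d`
  (`Nb > 2bR' + 2`, `N` even) with ALL image spins frozen to the alternating pattern of parity `p`.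
  For every NON-INCREASING `Λ^int`-local observable `g` and every nonnegative observable `F` of the
  torus not depending on the spins of the embedded `Λ^int`:
  `⟨g⟩^{η_p}_{Λ^int} · ⟨F⟩_𝕋 ≤ ⟨(g ∘ proj^*) · F⟩_𝕋`. Proof: condition the torus measure on the
  spins off the embedded `Λ^int` (DLR); the conditional measure is the box measure with the boundary
  condition read off the torus, transported to `ℤ^d`; on `∂Λ^int` that boundary condition agrees
  with `η_p` at the image sites (same frozen pattern, `torusPin_proj`) and is `≤ +1 = η_p` elsewhere,
  so by FKG it gives a larger expectation to the non-increasing `g`.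

No named facts are introduced (D-0014, D-0026).

## References

* A. C. D. van Enter, R. Fernández, A. D. Sokal, J. Stat. Phys. 72 (1993) 879–1167, Theorem 4.3,
  §4.3.1 Step 2 (the `+` exterior and FKG) [VanenterFernandezSokal1993].
* S. Friedli, Y. Velenik, *Statistical Mechanics of Lattice Systems*, CUP 2017, §3.1, Lemma 3.23,
  Exercise 3.11, Exercise 3.13, Lemma 6.7 [FriedliVelenik2017].
-/

noncomputable section

namespace Literature.Barriers.CriticalPhenomena.NonGibbs

open Finset MeasureTheory Literature.Probability.LatticeModels

/-! ### Transport of Gibbs expectations along a local isomorphism of graphs -/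

section Transport

variable {V V' : Type*} [DecidableEq V] [DecidableEq V'] (G : SimpleGraph V) (G' : SimpleGraph V')
  [G.LocallyFinite] [G'.LocallyFinite]

/-- **Transport of finite-volume Gibbs expectations with fixed boundary condition along a map of vertex
sets which is injective on `Λ ∪ ∂Λ` and a local isomorphism of graphs at `Λ`**:
`⟨f ∘ φ^*⟩^{ξ}_{φ(Λ);β,h} = ⟨f⟩^{ξ∘φ}_{Λ;β,h}` for `Λ`-local `f` (the Boltzmann sums of
Friedli–Velenik §3.1 eq. (3.8) are re-indexed by `τ ↦ τ ∘ φ`; the glued configurations agree on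
`Λ ∪ ∂Λ`, which is all the Hamiltonian `H_Λ` and `f` read). [cite: FriedliVelenik2017, §3.1 eq. (3.8)] -/
theorem isingExpect_fixed_transport (φ : V → V') (Λ : Finset V)
    (hinj : Set.InjOn φ ↑(Λ ∪ outerBoundary G Λ))
    (hadj : ∀ x ∈ Λ, ∀ y, G.Adj x y → G'.Adj (φ x) (φ y))
    (hadj' : ∀ x ∈ Λ, ∀ y', G'.Adj (φ x) y' → ∃ y, G.Adj x y ∧ φ y = y')
    (ξ : SpinConfig V') (β h : ℝ) {f : SpinConfig V → ℝ}
    (hf : ∀ σ σ' : SpinConfig V, (∀ x ∈ Λ, σ x = σ' x) → f σ = f σ') :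
    isingExpect G' (Λ.image φ) β h (.fixed ξ) (fun σ' => f (σ' ∘ φ)) = isingExpect G Λ β h (.fixed (ξ ∘ φ)) f := by
  classical
  have hfm : Measurable f := DependsOn.measurable_of_finset Λ hf
  have hf' : ∀ σ σ' : SpinConfig V', (∀ x' ∈ Λ.image φ, σ x' = σ' x') → f (σ ∘ φ) = f (σ' ∘ φ) :=
    fun σ σ' hσ => hf _ _ fun x hx => hσ (φ x) (mem_image_of_mem φ hx)
  have hfm' : Measurable fun σ' : SpinConfig V' => f (σ' ∘ φ) := DependsOn.measurable_of_finset (Λ.image φ) hf'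
  -- the bijection of finite configurations
  have hinjΛ : Set.InjOn φ ↑Λ := hinj.mono (by simp)
  let e : ↥Λ → ↥(Λ.image φ) := fun x => ⟨φ x, mem_image_of_mem φ x.2⟩
  have he : Function.Bijective e := by
    refine ⟨fun x y hxy => Subtype.ext (hinjΛ x.2 y.2 (congrArg Subtype.val hxy)), fun ⟨x', hx'⟩ => ?_⟩
    obtain ⟨x, hx, rfl⟩ := mem_image.1 hx'
    exact ⟨⟨x, hx⟩, rfl⟩
  let E : ↥Λ ≃ ↥(Λ.image φ) := Equiv.ofBijective e he
  -- glued configurations agree on `Λ ∪ ∂Λ` after pulling back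
  have hglue : ∀ (τ' : ↥(Λ.image φ) → ℤˣ) (x : V), x ∈ Λ ∪ outerBoundary G Λ →
      glue (Λ.image φ) τ' (.fixed ξ) (φ x) = glue Λ (τ' ∘ E) (.fixed (ξ ∘ φ)) x := by
    intro τ' x hx
    by_cases hxΛ : x ∈ Λ
    · rw [glue_apply_of_mem _ _ _ (mem_image_of_mem φ hxΛ), glue_apply_of_mem _ _ _ hxΛ]
      rfl
    · have hφx : φ x ∉ Λ.image φ := by
        intro h'
        obtain ⟨x₀, hx₀, hxx₀⟩ := mem_image.1 h'
        have : x₀ = x := hinj (by simp [hx₀]) hx hxx₀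
        exact hxΛ (this ▸ hx₀)
      rw [glue_apply_of_notMem _ _ _ hφx, glue_apply_of_notMem _ _ _ hxΛ]
      rfl
  -- endpoints of edges at `Λ` lie in `Λ ∪ ∂Λ`
  have hends : ∀ e ∈ edgesTouching G Λ, ∀ x ∈ e, x ∈ Λ ∪ outerBoundary G Λ := by
    intro e he x hxe
    by_cases hxΛ : x ∈ Λ
    · exact mem_union_left _ hxΛ
    · exact mem_union_right _ (mem_outerBoundary_of_mem_edgesTouching G he hxe hxΛ)
  -- the edge bijection `e ↦ e.map φ`
  have hmapmem : ∀ e ∈ edgesTouching G Λ, e.map φ ∈ edgesTouching G' (Λ.image φ) := by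
    intro e he
    obtain ⟨heG, x, hx, hxe⟩ := mem_edgesTouching_iff.1 he
    induction e using Sym2.ind with
    | _ a c =>
      have hadj0 : G.Adj a c := by simpa using heG
      rw [Sym2.map_mk, mem_edgesTouching_iff]
      rcases Sym2.mem_iff.1 hxe with rfl | rfl
      · exact ⟨by simpa using hadj x hx c hadj0, φ x, mem_image_of_mem φ hx, Sym2.mem_mk_left _ _⟩
      · exact ⟨by simpa using (hadj x hx a hadj0.symm).symm, φ x, mem_image_of_mem φ hx, Sym2.mem_mk_right _ _⟩
  have hmapinj : Set.InjOn (Sym2.map φ) ↑(edgesTouching G Λ) := by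
    intro e₁ he₁ e₂ he₂ heq
    have h1 := hends e₁ he₁
    have h2 := hends e₂ he₂
    induction e₁ using Sym2.ind with
    | _ a₁ c₁ =>
      induction e₂ using Sym2.ind with
      | _ a₂ c₂ =>
        simp only [Sym2.map_mk, Sym2.eq_iff] at heq
        rcases heq with ⟨ha, hc⟩ | ⟨ha, hc⟩
        · rw [hinj (h1 a₁ (Sym2.mem_mk_left _ _)) (h2 a₂ (Sym2.mem_mk_left _ _)) ha,
            hinj (h1 c₁ (Sym2.mem_mk_right _ _)) (h2 c₂ (Sym2.mem_mk_right _ _)) hc]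
        · rw [hinj (h1 a₁ (Sym2.mem_mk_left _ _)) (h2 c₂ (Sym2.mem_mk_right _ _)) ha,
            hinj (h1 c₁ (Sym2.mem_mk_right _ _)) (h2 a₂ (Sym2.mem_mk_left _ _)) hc, Sym2.eq_swap]
  have hmapsurj : ∀ e' ∈ edgesTouching G' (Λ.image φ), ∃ e ∈ edgesTouching G Λ, e.map φ = e' := by
    intro e' he'
    obtain ⟨heG', x', hx', hxe'⟩ := mem_edgesTouching_iff.1 he'
    obtain ⟨x, hx, rfl⟩ := mem_image.1 hx'
    induction e' using Sym2.ind with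
    | _ a' c' =>
      have hadj0 : G'.Adj a' c' := by simpa using heG'
      rcases Sym2.mem_iff.1 hxe' with h | h
      · subst h
        obtain ⟨y, hy, rfl⟩ := hadj' x hx c' hadj0
        exact ⟨s(x, y), mem_edgesTouching_iff.2 ⟨by simpa using hy, x, hx, Sym2.mem_mk_left _ _⟩, by simp⟩
      · subst h
        obtain ⟨y, hy, rfl⟩ := hadj' x hx a' hadj0.symm
        exact ⟨s(y, x), mem_edgesTouching_iff.2 ⟨by simpa using hy.symm, x, hx, Sym2.mem_mk_right _ _⟩, by simp⟩
  -- Hamiltonians agree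
  have hH : ∀ τ' : ↥(Λ.image φ) → ℤˣ,
      isingHamiltonian G' (Λ.image φ) h (.fixed ξ) (glue (Λ.image φ) τ' (.fixed ξ)) =
        isingHamiltonian G Λ h (.fixed (ξ ∘ φ)) (glue Λ (τ' ∘ E) (.fixed (ξ ∘ φ))) := by
    intro τ'
    simp only [isingHamiltonian, interactionEdges_fixed]
    congr 1
    · congr 1
      symm
      refine sum_bij (fun e _ => e.map φ) (fun e he => hmapmem e he) (fun e₁ he₁ e₂ he₂ h => hmapinj he₁ he₂ h)
        (fun e' he' => ?_) (fun e he => ?_)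
      · obtain ⟨e, he, hee'⟩ := hmapsurj e' he'
        exact ⟨e, he, hee'⟩
      · -- bond values
        induction e using Sym2.ind with
        | _ a c =>
          rw [Sym2.map_mk, bondSpin_mk, bondSpin_mk, spinAt, spinAt, spinAt, spinAt,
            hglue τ' a (hends _ he a (Sym2.mem_mk_left _ _)), hglue τ' c (hends _ he c (Sym2.mem_mk_right _ _))]
    · congr 1
      rw [sum_image fun x hx y hy hxy => hinjΛ hx hy hxy]
      refine sum_congr rfl fun x hx => ?_
      rw [spinAt, spinAt, hglue τ' x (mem_union_left _ hx)]
  -- the Boltzmann sums agree term by term under `τ' ↦ τ' ∘ E`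
  rw [isingExpect, isingExpect, integral_isingMeasure _ _ _ _ _ hfm', integral_isingMeasure _ _ _ _ _ hfm,
    isingPartitionFunction, isingPartitionFunction]
  have hterm : ∀ τ' : ↥(Λ.image φ) → ℤˣ,
      isingWeight G' (Λ.image φ) β h (.fixed ξ) τ' = isingWeight G Λ β h (.fixed (ξ ∘ φ)) (τ' ∘ E) := by
    intro τ'; rw [isingWeight, isingWeight, hH]
  have hval : ∀ τ' : ↥(Λ.image φ) → ℤˣ,
      f (glue (Λ.image φ) τ' (.fixed ξ) ∘ φ) = f (glue Λ (τ' ∘ E) (.fixed (ξ ∘ φ))) :=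
    fun τ' => hf _ _ fun x hx => by rw [Function.comp_apply, hglue τ' x (mem_union_left _ hx)]
  -- re-index
  let Φ : (↥(Λ.image φ) → ℤˣ) ≃ (↥Λ → ℤˣ) :=
    { toFun := fun τ' => τ' ∘ E, invFun := fun τ => τ ∘ E.symm,
      left_inv := fun τ' => by funext x; simp, right_inv := fun τ => by funext x; simp }
  have hΦ : ∀ τ', Φ τ' = τ' ∘ E := fun τ' => rfl
  congr 1
  · rw [← Equiv.sum_comp Φ]
    exact sum_congr rfl fun τ' _ => by rw [hΦ, ← hterm, ← hval]
  · rw [← Equiv.sum_comp Φ]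
    exact sum_congr rfl fun τ' _ => by rw [hΦ, ← hterm]

end Transport


/-! ### The DLR–FKG comparison of the `+`-exterior box with the pinned torus -/

section Compare

variable {d N b : ℕ} [NeZero (N * b)]

/-- Membership in the internal volume `Λ^int_{R'} = spacingIntVolume d b R'` (the sites of the cube
`box d (bR')` with a coordinate not divisible by `b`). [cite: VanenterFernandezSokal1993, §4.3.1 Step 2] -/
theorem mem_spacingIntVolume {R' : ℕ} {y : Site d} :
    y ∈ spacingIntVolume d b R' ↔ y ∈ box d (b * R') ∧ ¬ IsSpImageSite d b y := by
  rw [spacingIntVolume, mem_filter]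

/-- Negation of observables and expectations. [folklore] -/
theorem isingExpect_neg {V : Type*} [DecidableEq V] (G : SimpleGraph V) [G.LocallyFinite] (Λ : Finset V) (β h : ℝ)
    (bc : BoundaryCondition V) (f : SpinConfig V → ℝ) :
    isingExpect G Λ β h bc (fun σ => -f σ) = -isingExpect G Λ β h bc f := by
  rw [isingExpect, isingExpect, integral_neg]

/-- **A site of the outer boundary of `Λ^int_{R'}` divisible by `b` is an image site of the cube
`Λ_{R'}`** (an image neighbour `x ± eᵢ` of an internal site of `box d (bR')` lies in `box d (bR')`, since
`bR' + 1` is not divisible by `b ≥ 2`). [cite: VanenterFernandezSokal1993, §4.3.1 Step 2] -/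
theorem mem_box_of_mem_outerBoundary_spacingIntVolume (hb : 2 ≤ b) {R' : ℕ} {y : Site d}
    (hy : y ∈ outerBoundary (zdGraph d) (spacingIntVolume d b R')) (himg : IsSpImageSite d b y) :
    y ∈ box d (b * R') := by
  obtain ⟨-, x, hx, hadj⟩ := mem_outerBoundary_iff.1 hy
  obtain ⟨hxbox, -⟩ := mem_spacingIntVolume.1 hx
  rw [mem_box] at hxbox ⊢
  obtain ⟨i, h | h⟩ := (zdGraph_adj_iff y x).1 hadj
  · -- `x = y + eᵢ`
    intro j
    have hxj := hxbox j
    rw [h] at hxj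
    by_cases hj : j = i
    · subst hj
      simp only [Pi.add_apply, Pi.single_eq_same] at hxj
      refine ⟨?_, by omega⟩
      by_contra hlt
      have hyj : y j = -(b * R' : ℕ) - 1 := by push_cast; omega
      obtain ⟨c, hc⟩ := himg j
      have : (b : ℤ) ∣ 1 := ⟨-(R' : ℤ) - c, by push_cast at hyj; linarith⟩
      have := Int.le_of_dvd one_pos this
      omega
    · simp only [Pi.add_apply, Pi.single_eq_of_ne hj, add_zero] at hxj
      exact hxj
  · -- `y = x + eᵢ`
    intro j
    have hxj := hxbox j
    by_cases hj : j = i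
    · subst hj
      have hyj : y j = x j + 1 := by rw [h]; simp
      refine ⟨by omega, ?_⟩
      by_contra hlt
      have hyj' : y j = (b * R' : ℕ) + 1 := by push_cast; omega
      obtain ⟨c, hc⟩ := himg j
      have : (b : ℤ) ∣ 1 := ⟨c - R', by push_cast at hyj'; linarith⟩
      have := Int.le_of_dvd one_pos this
      omega
    · have hyj : y j = x j := by rw [h]; simp [hj]
      rw [hyj]; exact hxj

/-- **The DLR–FKG comparison** (Friedli–Velenik Lemma 6.7 / Exercise 3.11 with Exercise 3.13; the
finite-volume mechanism behind "let `μ^{(+)}_{∞;±}` be the `+` phase (i.e. the maximal Gibbs measure in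
FKG sense)", §4.3.1 Step 2.4). Embed the cube `Λ_{R'}` in the torus `(ℤ/Nbℤ)^d`, `Nb > 2bR' + 2`, `N`
even, `b ≥ 2`, all image spins frozen to the alternating pattern of parity `p`. Then for every
non-increasing `Λ^int_{R'}`-local observable `g` of `ℤ^d` and every nonnegative observable
`F` of the torus not depending on the spins of the embedded `Λ^int_{R'}`:
`⟨g⟩^{η_p}_{Λ^int_{R'};β,0} · ⟨F⟩_𝕋 ≤ ⟨(g ∘ proj^*) F⟩_𝕋`, where `η_p = signedCoreAnnulusBC d b p R' R' 1 1`
is the boundary condition of `VEFS1993_plusPhase` (`β ≥ 0`).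
[cite: FriedliVelenik2017, Lemma 6.7 and Exercise 3.13] -/
theorem isingExpect_mul_tExpect_le (hN : Even N) (hb : 2 ≤ b) {β : ℝ} (hβ : 0 ≤ β) (p : ℤˣ) (R' : ℕ)
    (hbig : 2 * (b * R' + 1) < N * b)
    {g : SpinConfig (Site d) → ℝ} (hga : Antitone g)
    (hgl : ∀ σ σ' : SpinConfig (Site d), (∀ x ∈ spacingIntVolume d b R', σ x = σ' x) → g σ = g σ')
    {F : SpinConfig (TorusSite d (N * b)) → ℝ} (hF0 : ∀ σ, 0 ≤ F σ)
    (hFl : ∀ σ σ' : SpinConfig (TorusSite d (N * b)),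
      (∀ x, x ∉ (spacingIntVolume d b R').image (Torus.proj (N * b)) → σ x = σ' x) → F σ = F σ') :
    isingExpect (zdGraph d) (spacingIntVolume d b R') β 0 (.fixed (signedCoreAnnulusBC d b p R' R' 1 1)) g *
        tExpect N b p β F ≤
      tExpect N b p β (fun σ' => g (σ' ∘ Torus.proj (N * b)) * F σ') := by
  classical
  set Λ := spacingIntVolume d b R' with hΛ
  set W₀ := Λ.image (Torus.proj (N * b)) with hW₀
  set ηp := signedCoreAnnulusBC d b p R' R' 1 1 with hηp
  set ζ : SpinConfig (TorusSite d (N * b)) := torusPin N b p with hζ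
  set A := isingExpect (zdGraph d) Λ β 0 (.fixed ηp) g with hA
  have hb0 : 0 < b := by omega
  have hL2 : 2 ≤ N * b := by omega
  -- the embedded volume consists of internal sites
  have hW₀free : W₀ ⊆ tFree N b := by
    intro x hx
    obtain ⟨y, hy, rfl⟩ := mem_image.1 hx
    exact mem_tFree.2 fun h => (mem_spacingIntVolume.1 hy).2 (tImg_proj_iff.1 h)
  -- injectivity of the projection near the cube
  have hboxinj : ∀ u v : Site d, u ∈ box d (b * R' + 1) → v ∈ box d (b * R' + 1) →
      Torus.proj (N * b) u = Torus.proj (N * b) v → u = v := by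
    intro u v hu hv huv
    refine eq_of_proj_eq_of_abs_lt huv fun i => ?_
    have h1 := (mem_box.1 hu) i
    have h2 := (mem_box.1 hv) i
    rw [abs_lt]
    have : (2 * (b * R' + 1) : ℤ) < (N * b : ℕ) := by exact_mod_cast hbig
    push_cast at h1 h2 this ⊢
    constructor <;> linarith
  have hnear : ∀ x ∈ Λ ∪ outerBoundary (zdGraph d) Λ, x ∈ box d (b * R' + 1) := by
    intro x hx
    rcases mem_union.1 hx with hx | hx
    · exact box_mono _ (by omega) (mem_spacingIntVolume.1 hx).1
    · obtain ⟨-, y, hy, hadj⟩ := mem_outerBoundary_iff.1 hx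
      exact mem_box_succ_of_adj (mem_spacingIntVolume.1 hy).1 hadj
  have hinj : Set.InjOn (Torus.proj (N * b)) ↑(Λ ∪ outerBoundary (zdGraph d) Λ) :=
    fun u hu v hv huv => hboxinj u v (hnear u hu) (hnear v hv) huv
  -- the transport identity for every boundary condition of the torus
  have htransport : ∀ ξ : SpinConfig (TorusSite d (N * b)),
      isingExpect (torusGraph d (N * b)) W₀ β 0 (.fixed ξ) (fun σ' => g (σ' ∘ Torus.proj (N * b))) =
        isingExpect (zdGraph d) Λ β 0 (.fixed (ξ ∘ Torus.proj (N * b))) g :=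
    fun ξ => isingExpect_fixed_transport (zdGraph d) (torusGraph d (N * b)) (Torus.proj (N * b)) Λ hinj
      (fun x _ y hxy => torusGraph_adj_proj_of_adj hL2 hxy)
      (fun x _ y' hxy' => (torusGraph_adj_proj_iff hL2).1 hxy') ξ β 0 hgl
  -- FKG: a boundary condition read off a pinned torus configuration gives more weight to `g` than `η_p`
  have hfkg : ∀ ξ : SpinConfig (TorusSite d (N * b)), (∀ x, x ∉ tFree N b → ξ x = ζ x) →
      A ≤ isingExpect (zdGraph d) Λ β 0 (.fixed (ξ ∘ Torus.proj (N * b))) g := by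
    intro ξ hξ
    set η' : SpinConfig (Site d) := ξ ∘ Torus.proj (N * b) with hη'
    set ηhat : SpinConfig (Site d) := fun y => if y ∈ outerBoundary (zdGraph d) Λ then η' y else ηp y with hηhat
    have hgm : Measurable g := DependsOn.measurable_of_finset Λ hgl
    have hcongr : isingExpect (zdGraph d) Λ β 0 (.fixed η') g = isingExpect (zdGraph d) Λ β 0 (.fixed ηhat) g :=
      isingExpect_fixed_congr_outerBoundary (zdGraph d) (fun y hy => by simp only [hηhat, if_pos hy]) β 0 hgm hgl
    have hle : ηhat ≤ ηp := by
      intro y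
      simp only [hηhat]
      split_ifs with hy
      · by_cases himg : IsSpImageSite d b y
        · -- an image site of the cube: both read the frozen pattern
          have hybox := mem_box_of_mem_outerBoundary_spacingIntVolume hb hy himg
          choose w hw using himg
          have hyw : y = fun i => (b : ℤ) * w i := funext hw
          have hwbox : w ∈ box d R' := by
            rw [mem_box] at hybox ⊢
            intro i
            have := hybox i
            rw [hw i] at this
            have hbz : (0 : ℤ) < b := by exact_mod_cast hb0
            push_cast at this
            constructor <;> nlinarith
          have h1 : η' y = p * altConfig d w := by
            simp only [hη', Function.comp_apply]
            have hyimg : ¬ Torus.proj (N * b) y ∈ tFree N b := by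
              rw [mem_tFree, not_not, hyw, proj_mul_eq_tImg]; exact tImg_tImg w
            rw [hξ _ hyimg, hζ, hyw, proj_mul_eq_tImg, torusPin_proj hN hb0]
          have h2 : ηp y = p * altConfig d w := by
            have hdiv : ∀ i, (b : ℤ) ∣ y i := fun i => ⟨w i, hw i⟩
            have hquot : (fun i => y i / b) = w := by
              funext i; rw [hw i]; exact Int.mul_ediv_cancel_left _ (by exact_mod_cast hb0.ne')
            simp only [hηp, signedCoreAnnulusBC, hdiv, hquot, hwbox]
            simp
          rw [h1, h2]
        · -- an internal site outside the cube: `η_p = 1`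
          have h2 : ηp y = 1 := by
            have : ¬ ∀ i, (b : ℤ) ∣ y i := himg
            simp only [hηp, signedCoreAnnulusBC, this, false_and, if_false]
          rw [h2]; exact intUnits_le_one _
      · exact le_rfl
    have hmono := isingExpect_fixed_mono (zdGraph d) hβ Λ 0 hle (f := fun σ => -g σ)
      (fun σ τ hστ => neg_le_neg (hga hστ)) hgm.neg
    rw [isingExpect_neg, isingExpect_neg] at hmono
    rw [hcongr]
    linarith
  -- the Boltzmann sums of the torus, conditioned on the spins off `W₀` (DLR)
  have hsum : ∀ Φ : SpinConfig (TorusSite d (N * b)) → ℝ,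
      tExpect N b p β Φ = (∑ τ : ↥(tFree N b) → ℤˣ, isingWeight (torusGraph d (N * b)) (tFree N b) β 0 (.fixed ζ) τ *
        Φ (glue (tFree N b) τ (.fixed ζ))) / isingPartitionFunction (torusGraph d (N * b)) (tFree N b) β 0 (.fixed ζ) := by
    intro Φ
    rw [tExpect, isingExpect, integral_isingMeasure _ _ _ _ _ (measurable_of_finite Φ)]
  obtain ⟨Rw, hRwpos, hRw⟩ := exists_sum_isingWeight_fixed_eq (torusGraph d (N * b)) hW₀free ζ β 0
  -- inner sums
  set gT : SpinConfig (TorusSite d (N * b)) → ℝ := fun σ' => g (σ' ∘ Torus.proj (N * b)) with hgT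
  have hinner : ∀ τ₂ : ↥(tFree N b \ W₀) → ℤˣ,
      A * (F (glue (tFree N b \ W₀) τ₂ (.fixed ζ)) *
          isingPartitionFunction (torusGraph d (N * b)) W₀ β 0 (.fixed (glue (tFree N b \ W₀) τ₂ (.fixed ζ)))) ≤
        ∑ τ₁ : ↥W₀ → ℤˣ, isingWeight (torusGraph d (N * b)) W₀ β 0 (.fixed (glue (tFree N b \ W₀) τ₂ (.fixed ζ))) τ₁ *
          (gT (glue W₀ τ₁ (.fixed (glue (tFree N b \ W₀) τ₂ (.fixed ζ)))) *
            F (glue W₀ τ₁ (.fixed (glue (tFree N b \ W₀) τ₂ (.fixed ζ))))) := by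
    intro τ₂
    set ξ := glue (tFree N b \ W₀) τ₂ (.fixed ζ) with hξ
    have hFconst : ∀ τ₁ : ↥W₀ → ℤˣ, F (glue W₀ τ₁ (.fixed ξ)) = F ξ :=
      fun τ₁ => hFl _ _ fun x hx => by rw [glue_apply_of_notMem _ _ _ hx]; rfl
    simp only [hFconst]
    have hE : isingExpect (torusGraph d (N * b)) W₀ β 0 (.fixed ξ) gT =
        (∑ τ₁ : ↥W₀ → ℤˣ, isingWeight (torusGraph d (N * b)) W₀ β 0 (.fixed ξ) τ₁ * gT (glue W₀ τ₁ (.fixed ξ))) /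
          isingPartitionFunction (torusGraph d (N * b)) W₀ β 0 (.fixed ξ) := by
      rw [isingExpect, integral_isingMeasure _ _ _ _ _ (measurable_of_finite gT)]
    have hZpos := isingPartitionFunction_pos (torusGraph d (N * b)) W₀ β 0 (.fixed ξ)
    have hξpin : ∀ x, x ∉ tFree N b → ξ x = ζ x := fun x hx => by
      rw [hξ, glue_apply_of_notMem _ _ _ (fun h => hx (mem_sdiff.1 h).1)]; rfl
    have hAle : A ≤ isingExpect (torusGraph d (N * b)) W₀ β 0 (.fixed ξ) gT := by
      rw [hgT, htransport ξ]; exact hfkg ξ hξpin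
    rw [hE, le_div_iff₀ hZpos] at hAle
    calc A * (F ξ * isingPartitionFunction (torusGraph d (N * b)) W₀ β 0 (.fixed ξ))
        = F ξ * (A * isingPartitionFunction (torusGraph d (N * b)) W₀ β 0 (.fixed ξ)) := by ring
      _ ≤ F ξ * ∑ τ₁ : ↥W₀ → ℤˣ, isingWeight (torusGraph d (N * b)) W₀ β 0 (.fixed ξ) τ₁ * gT (glue W₀ τ₁ (.fixed ξ)) :=
          mul_le_mul_of_nonneg_left hAle (hF0 _)
      _ = _ := by rw [mul_sum]; exact sum_congr rfl fun τ₁ _ => by ring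
  -- assemble
  have hZT := isingPartitionFunction_pos (torusGraph d (N * b)) (tFree N b) β 0 (.fixed ζ)
  rw [hsum F, hsum (fun σ' => gT σ' * F σ'), ← mul_div_assoc, div_le_div_iff_of_pos_right hZT,
    hRw F, hRw (fun σ' => gT σ' * F σ'), mul_sum]
  refine sum_le_sum fun τ₂ _ => ?_
  have hden : ∑ τ₁ : ↥W₀ → ℤˣ, isingWeight (torusGraph d (N * b)) W₀ β 0 (.fixed (glue (tFree N b \ W₀) τ₂ (.fixed ζ))) τ₁ *
      F (glue W₀ τ₁ (.fixed (glue (tFree N b \ W₀) τ₂ (.fixed ζ)))) =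
        F (glue (tFree N b \ W₀) τ₂ (.fixed ζ)) *
          isingPartitionFunction (torusGraph d (N * b)) W₀ β 0 (.fixed (glue (tFree N b \ W₀) τ₂ (.fixed ζ))) := by
    have hFconst : ∀ τ₁ : ↥W₀ → ℤˣ, F (glue W₀ τ₁ (.fixed (glue (tFree N b \ W₀) τ₂ (.fixed ζ)))) =
        F (glue (tFree N b \ W₀) τ₂ (.fixed ζ)) :=
      fun τ₁ => hFl _ _ fun x hx => by rw [glue_apply_of_notMem _ _ _ hx]; rfl
    simp only [hFconst, isingPartitionFunction, mul_sum]
    exact sum_congr rfl fun τ₁ _ => by ring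
  rw [hden]
  calc A * (Rw τ₂ * (F (glue (tFree N b \ W₀) τ₂ (.fixed ζ)) *
        isingPartitionFunction (torusGraph d (N * b)) W₀ β 0 (.fixed (glue (tFree N b \ W₀) τ₂ (.fixed ζ)))))
      = Rw τ₂ * (A * (F (glue (tFree N b \ W₀) τ₂ (.fixed ζ)) *
        isingPartitionFunction (torusGraph d (N * b)) W₀ β 0 (.fixed (glue (tFree N b \ W₀) τ₂ (.fixed ζ))))) := by ring
    _ ≤ _ := mul_le_mul_of_nonneg_left (hinner τ₂) (hRwpos τ₂).le

end Compare

end Literature.Barriers.CriticalPhenomena.NonGibbs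

end
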